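import Literature.Probability.LatticeModels.VillainDirichletLimit
import Literature.Probability.LatticeModels.VillainKernelPoisson
import Literature.Probability.LatticeModels.GinibreCharacterExpansion
import HarnessLib

/-!
# The integer-current (character) expansion of the pinned Villain rotator and Griffiths' first
# inequality: `∫ cos(θ̄_a − θ̄_b) W_κ = (2π)^{|V|} ∑_{n : div n = δ_b − δ_a} ∏_e e^{-n_e²/2κ_e}/√(2πκ_e) ≥ 0`

Complement to the proof files of the named fact
`Literature.Probability.LatticeModels.FrohlichSpencerVillainSpinWaveBound` (`VillainSpinWave.lean`;
Dario–Wu 2020 Prop. 1.1 after Fröhlich–Spencer 1982). For a finite vertex set `V`, edges `e : ι`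
with end-points `s e, t e ∈ Option V` (`none` = the grounded boundary, angle `0`), stiffnesses
`κ_e > 0` and sites `a, b ∈ Option V`, the Gibbs integral of the two-point observable against the
pinned Villain weight `W_κ(θ) = ∏_e v_{κ_e}(θ̄(t e) − θ̄(s e))` over the angle cube `[-π,π)^V` is a
sum over INTEGER EDGE CURRENTS `n ∈ ℤ^ι` satisfying Kirchhoff's law at every free vertex with unit
source at `b` and sink at `a`, weighted by the positive dual (Gaussian) weights
`∏_e e^{-n_e²/(2κ_e)}/√(2πκ_e)` — the "worm" / `ℤ`-current representation of the Villain model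
(FS82 §2.1 (i), (2.3); Wallin et al. 1994 §II), here for arbitrary graphs with pinned vertices:

* `twistChar_pinned_eq_one_iff` — on the torus `U(1)^V`, the twisted character
  `u ↦ (ū_a/ū_b) ∏_e (ū_{t e}/ū_{s e})^{n_e}` is trivial iff the current `n` satisfies
  `[a = v] − [b = v] + ∑_e ([t e = v] − [s e = v]) n_e = 0` at every vertex `v` (evaluate at
  `u = mulSingle v z`, `z = e^{iπ/m}`);
* **`setIntegral_cos_mul_pinnedWeight_eq_tsum`** — the expansion itself, from the Poisson form of
  the kernel (`hasSum_villainKernel_fourier_circle`: `v_κ(arg z) = ∑_m (e^{-m²/2κ}/√(2πκ)) z^m`) and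
  the tree's character expansion on compact abelian groups (`integral_coe_char_mul_prod_tsum`:
  Fubini plus orthogonality), transported between `U(1)^V` and the angle cube (`CircleHaar`);
* `setIntegral_cos_mul_pinnedWeight_nonneg`, `pinnedVillainTwoPoint_nonneg` — **Griffiths' first
  inequality** `⟨cos(θ̄_a − θ̄_b)⟩_κ ≥ 0` (Ginibre 1970, for the Villain interaction: all dual weights
  are positive);
* `dirichletVillainTwoPoint_nonneg`, `ciInf_dirichletVillainTwoPoint_nonneg` — for the cubes with zero
  boundary condition of the named fact and for their (proved) thermodynamic limit: `0 ≤ G ≤ 1`.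

Theorems only; no definition and no named fact is introduced.

## References

* [Ginibre1970] J. Ginibre, Comm. Math. Phys. 16 (1970) 310–328 (Griffiths' inequalities for plane
  rotators).
* [FrohlichSpencerCMP1982] J. Fröhlich, T. Spencer, Comm. Math. Phys. 83 (1982) 411–454, §2.1 (i),
  §2.2 (2.3), §2.3 (character / duality expansion).
* [WallinEtAl1994] M. Wallin, E. Sørensen, S. Girvin, A. P. Young, Phys. Rev. B 49 (1994) 12115,
  §II (integer-current representation of Villain rotors).
* [DarioWu2020] P. Dario, W. Wu, arXiv:2002.02946, Ch. 1 §1 (PDF p. 4).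
-/

noncomputable section

open MeasureTheory Filter Finset Set Complex
open scoped Topology BigOperators Real

namespace Literature.Probability.LatticeModels

open Literature.MathematicalPhysics.QuantumFieldTheory

variable {V ι : Type*} [Fintype V] [Fintype ι] [DecidableEq V]

/-- **Triviality of the twisted character = Kirchhoff's law for the current.** Let
`χ_{o,o'}(u) = ū_o/ū_{o'}` on `U(1)^V` (`ū_{some v} = u_v`, `ū_{none} = 1`). For a current
`n ∈ ℤ^ι`, the character `u ↦ χ_{a,b}(u) ∏_e χ_{t e, s e}(u)^{n_e}` is trivial iff at every vertex
`v`: `[a = v] − [b = v] + ∑_e ([t e = v] − [s e = v]) n_e = 0` (evaluate at `u = mulSingle v z`,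
where the character is `z^{m_v}`, and `z = e^{iπ/m_v}` gives `-1` unless `m_v = 0`). [folklore] -/
theorem twistChar_pinned_eq_one_iff (χf : Option V → Option V → (V → Circle) →ₜ* Circle)
    (hχf : ∀ o o' u, χf o o' u = o.elim 1 u / o'.elim 1 u) (s t : ι → Option V) (a b : Option V)
    (n : ι → ℤ) :
    twistChar (fun e => χf (t e) (s e)) (χf a b) n = 1 ↔
      ∀ v : V, ((if a = some v then (1 : ℤ) else 0) - (if b = some v then 1 else 0)) +
        ∑ e, ((if t e = some v then (1 : ℤ) else 0) - (if s e = some v then 1 else 0)) * n e = 0 := by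
  -- the value of the pinned coordinate at a single-vertex configuration
  have hind : ∀ (o : Option V) (v : V) (z : Circle),
      o.elim (1 : Circle) (Pi.mulSingle v z) = z ^ (if o = some v then (1 : ℤ) else 0) := by
    intro o v z
    cases o with
    | none => simp
    | some w =>
      show (Pi.mulSingle v z : V → Circle) w = z ^ (if some w = some v then (1 : ℤ) else 0)
      by_cases hw : w = v
      · subst hw; simp
      · rw [Pi.mulSingle_eq_of_ne hw, if_neg (fun h => hw (Option.some_injective _ h)), zpow_zero]
  have hzsum : ∀ (z : Circle) (f : ι → ℤ) (S : Finset ι), ∏ e ∈ S, z ^ f e = z ^ ∑ e ∈ S, f e := by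
    classical
    intro z f S
    induction S using Finset.induction_on with
    | empty => simp
    | insert e S he ih => rw [Finset.prod_insert he, Finset.sum_insert he, ih, zpow_add]
  -- the character at a single-vertex configuration is `z^{m_v}`
  have hsingle : ∀ (v : V) (z : Circle),
      twistChar (fun e => χf (t e) (s e)) (χf a b) n (Pi.mulSingle v z) =
        z ^ (((if a = some v then (1 : ℤ) else 0) - (if b = some v then 1 else 0)) +
          ∑ e, ((if t e = some v then (1 : ℤ) else 0) - (if s e = some v then 1 else 0)) * n e) := by
    intro v z
    rw [twistChar_apply, hχf, hind, hind, div_eq_mul_inv, ← zpow_neg, ← zpow_add, ← sub_eq_add_neg,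
      zpow_add, ← hzsum]
    congr 1
    refine Finset.prod_congr rfl fun e _ => ?_
    rw [hχf, hind, hind, div_eq_mul_inv, ← zpow_neg, ← zpow_add, ← sub_eq_add_neg, ← zpow_mul]
  constructor
  · intro h v
    by_contra hm
    set m : ℤ := ((if a = some v then (1 : ℤ) else 0) - (if b = some v then 1 else 0)) +
      ∑ e, ((if t e = some v then (1 : ℤ) else 0) - (if s e = some v then 1 else 0)) * n e with hmdef
    have hz := hsingle v (Circle.exp (Real.pi / m))
    rw [h] at hz
    -- `1 = e^{iπ/m·m} = e^{iπ} = -1`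
    have hC : ((Circle.exp (Real.pi / m) ^ m : Circle) : ℂ) = -1 := by
      rw [Circle.coe_zpow, Circle.coe_exp, ← Complex.exp_int_mul]
      have hm' : (m : ℂ) ≠ 0 := by exact_mod_cast hm
      rw [show (m : ℂ) * (((Real.pi / m : ℝ)) * Complex.I) = Real.pi * Complex.I by
        push_cast; field_simp, Complex.exp_pi_mul_I]
    have h1 : ((1 : Circle) : ℂ) = -1 := by
      rw [show (1 : Circle) = Circle.exp (Real.pi / m) ^ m from hz, hC]
    norm_num at h1
  · intro h
    refine ContinuousMonoidHom.ext fun u => ?_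
    rw [ContinuousMonoidHom.coe_one, Pi.one_apply, ← Finset.univ_prod_mulSingle u, map_prod]
    simp only [hsingle, h, zpow_zero, Finset.prod_const_one]

/-- **The integer-current expansion of the pinned Villain two-point numerator.** For
`V, ι` finite, end-points `s e, t e ∈ Option V`, stiffnesses `κ_e > 0`, sites `a, b ∈ Option V`:
`∫_{[-π,π)^V} cos(θ̄_a − θ̄_b) ∏_e v_{κ_e}(θ̄(t e) − θ̄(s e)) dθ
  = (2π)^{|V|} ∑_{n ∈ ℤ^ι} [Kirchhoff: [a=v] − [b=v] + ∑_e([t e=v] − [s e=v]) n_e = 0 ∀ v] ∏_e e^{-n_e²/(2κ_e)}/√(2πκ_e)`: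
on `U(1)^V` the weight is the product of the character series
`v_κ(arg z) = ∑_m (e^{-m²/2κ}/√(2πκ)) z^m` (`hasSum_villainKernel_fourier_circle`) in the edge characters
`u ↦ ū_{t e}/ū_{s e}`, the observable is `Re` of the character `ū_a/ū_b`, and the character
expansion `integral_coe_char_mul_prod_tsum` (Fubini + orthogonality) applies; the integral of the
imaginary part vanishes because the result is real.
[cite: FrohlichSpencerCMP1982, §2.1 (i), §2.2 (2.3), §2.3 (duality transformation)] -/
theorem setIntegral_cos_mul_pinnedWeight_eq_tsum (s t : ι → Option V) {κ : ι → ℝ}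
    (hκ : ∀ e, 0 < κ e) (a b : Option V) :
    ∫ θ in angleCube V, Real.cos (a.elim (0 : ℝ) θ - b.elim 0 θ) *
        ∏ e, villainKernel (κ e) ((t e).elim (0 : ℝ) θ - (s e).elim 0 θ) =
      (2 * Real.pi) ^ Fintype.card V * ∑' n : ι → ℤ,
        if (∀ v : V, ((if a = some v then (1 : ℤ) else 0) - (if b = some v then 1 else 0)) +
            ∑ e, ((if t e = some v then (1 : ℤ) else 0) - (if s e = some v then 1 else 0)) * n e = 0)
        then ∏ e, Real.exp (-((n e : ℝ) ^ 2) / (2 * κ e)) / Real.sqrt (2 * π * κ e) else 0 := by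
  classical
  haveI : (haarProbability Circle).IsHaarMeasure := by
    unfold haarProbability; infer_instance
  -- the torus `U(1)^V`, its Haar probability measure, and the angle map
  set μ : Measure (V → Circle) := Measure.pi fun _ => haarProbability Circle with hμdef
  set E : (V → ℝ) → (V → Circle) := fun θ v => Circle.exp (θ v) with hEdef
  -- extension of a torus point to `Option V` by `1` at the grounded boundary
  obtain ⟨ext, hext⟩ : ∃ ext : (V → Circle) → Option V → Circle, ∀ u o, ext u o = o.elim 1 u :=
    ⟨_, fun _ _ => rfl⟩
  have hext_one : ∀ o, ext 1 o = 1 := fun o => by rw [hext]; cases o <;> rfl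
  have hext_mul : ∀ u u' o, ext (u * u') o = ext u o * ext u' o := fun u u' o => by
    simp only [hext]; cases o <;> simp
  have hext_cont : ∀ o : Option V, Continuous fun u : V → Circle => ext u o := by
    intro o
    rw [show (fun u : V → Circle => ext u o) = fun u => o.elim 1 u from funext fun u => hext u o]
    cases o with
    | none => exact continuous_const
    | some v => exact continuous_apply v
  have hextE : ∀ (θ : V → ℝ) (o : Option V), ext (E θ) o = Circle.exp (o.elim (0 : ℝ) θ) := by
    intro θ o
    rw [hext]
    cases o with
    | none => simp
    | some v => simp [hEdef]
  -- the characters `u ↦ ext u o / ext u o'`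
  have mkChar : ∀ o o' : Option V, ∃ χ : (V → Circle) →ₜ* Circle, ∀ u, χ u = ext u o / ext u o' := by
    intro o o'
    refine ⟨{ toFun := fun u => ext u o / ext u o'
              map_one' := by simp only [hext_one, div_one]
              map_mul' := fun u u' => by simp only [hext_mul]; exact mul_div_mul_comm _ _ _ _
              continuous_toFun := (hext_cont o).div' (hext_cont o') }, fun u => rfl⟩
  choose χf hχf using mkChar
  have hχf' : ∀ o o' u, χf o o' u = o.elim 1 u / o'.elim 1 u := fun o o' u => by
    rw [hχf, hext, hext]
  set χ : ι → (V → Circle) →ₜ* Circle := fun e => χf (t e) (s e) with hχdef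
  set χ₀ : (V → Circle) →ₜ* Circle := χf a b with hχ₀def
  -- the Fourier coefficients of the edge weights
  set c : ι → ℤ → ℂ := fun e m =>
    ((Real.exp (-((m : ℝ) ^ 2) / (2 * κ e)) / Real.sqrt (2 * π * κ e) : ℝ) : ℂ) with hcdef
  have hc : ∀ e, Summable fun m => ‖c e m‖ := fun e => summable_norm_villainFourierTerm (hκ e)
  -- the weight on the torus and its character expansion
  set Wt : (V → Circle) → ℝ := fun u =>
    ∏ e, villainKernel (κ e) (Complex.arg ((χ e u : Circle) : ℂ)) with hWtdef
  have hWt : ∀ u, (Wt u : ℂ) = ∏ e, ∑' m : ℤ, c e m * ((χ e u : Circle) : ℂ) ^ m := fun u => by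
    rw [hWtdef, ofReal_prod]
    refine Finset.prod_congr rfl fun e _ => ?_
    exact ((hasSum_villainKernel_fourier_circle (hκ e) (χ e u)).tsum_eq).symm
  -- ## the character expansion: `∫ χ₀ W dμ` is the (real) current sum
  have hexp := integral_coe_char_mul_prod_tsum μ χ χ₀ hc
  have hiff : ∀ n : ι → ℤ, twistChar χ χ₀ n = 1 ↔
      ∀ v : V, ((if a = some v then (1 : ℤ) else 0) - (if b = some v then 1 else 0)) +
        ∑ e, ((if t e = some v then (1 : ℤ) else 0) - (if s e = some v then 1 else 0)) * n e = 0 :=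
    fun n => twistChar_pinned_eq_one_iff χf hχf' s t a b n
  have hterm : ∀ n : ι → ℤ, (if twistChar χ χ₀ n = 1 then ∏ e, c e (n e) else 0) =
      (((if (∀ v : V, ((if a = some v then (1 : ℤ) else 0) - (if b = some v then 1 else 0)) +
            ∑ e, ((if t e = some v then (1 : ℤ) else 0) - (if s e = some v then 1 else 0)) * n e = 0)
        then ∏ e, Real.exp (-((n e : ℝ) ^ 2) / (2 * κ e)) / Real.sqrt (2 * π * κ e) else 0 : ℝ)) : ℂ) := by
    intro n
    by_cases h : ∀ v : V, ((if a = some v then (1 : ℤ) else 0) - (if b = some v then 1 else 0)) +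
        ∑ e, ((if t e = some v then (1 : ℤ) else 0) - (if s e = some v then 1 else 0)) * n e = 0
    · rw [if_pos ((hiff n).2 h), if_pos h, hcdef, ofReal_prod]
    · rw [if_neg (fun h' => h ((hiff n).1 h')), if_neg h, ofReal_zero]
  have hint_eq : ∫ u, ((χ₀ u : Circle) : ℂ) * (Wt u : ℂ) ∂μ =
      ((∑' n : ι → ℤ, (if (∀ v : V, ((if a = some v then (1 : ℤ) else 0) - (if b = some v then 1 else 0)) +
            ∑ e, ((if t e = some v then (1 : ℤ) else 0) - (if s e = some v then 1 else 0)) * n e = 0)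
        then ∏ e, Real.exp (-((n e : ℝ) ^ 2) / (2 * κ e)) / Real.sqrt (2 * π * κ e) else 0 : ℝ) : ℝ) : ℂ) := by
    simp_rw [hWt]
    rw [hexp]
    simp_rw [hterm]
    exact (ofReal_tsum _).symm
  -- ## the real part: `∫ Re χ₀ · W dμ` equals the current sum
  have hWc : Continuous Wt :=
    continuous_finsetProd _ fun e _ => (continuous_villainKernel_arg (hκ e)).comp (χ e).continuous
  have hGc : Continuous fun u : V → Circle => ((χ₀ u : Circle) : ℂ) * (Wt u : ℂ) :=
    (continuous_subtype_val.comp χ₀.continuous).mul (continuous_ofReal.comp hWc)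
  have hGi : Integrable (fun u : V → Circle => ((χ₀ u : Circle) : ℂ) * (Wt u : ℂ)) μ :=
    hGc.integrable_of_hasCompactSupport (HasCompactSupport.of_compactSpace _)
  have hre : ∫ u, ((χ₀ u : Circle) : ℂ).re * Wt u ∂μ =
      ∑' n : ι → ℤ, (if (∀ v : V, ((if a = some v then (1 : ℤ) else 0) - (if b = some v then 1 else 0)) +
            ∑ e, ((if t e = some v then (1 : ℤ) else 0) - (if s e = some v then 1 else 0)) * n e = 0)
        then ∏ e, Real.exp (-((n e : ℝ) ^ 2) / (2 * κ e)) / Real.sqrt (2 * π * κ e) else 0 : ℝ) := by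
    have h2 : ∫ u, (((χ₀ u : Circle) : ℂ) * (Wt u : ℂ)).re ∂μ =
        (∫ u, ((χ₀ u : Circle) : ℂ) * (Wt u : ℂ) ∂μ).re := integral_re hGi
    have h1 : ∫ u, ((χ₀ u : Circle) : ℂ).re * Wt u ∂μ = ∫ u, (((χ₀ u : Circle) : ℂ) * (Wt u : ℂ)).re ∂μ :=
      integral_congr_ae (ae_of_all _ fun u => by simp only [Complex.re_mul_ofReal])
    rw [h1, h2, hint_eq, ofReal_re]
  -- ## transfer to the angle cube
  have htr : ∀ G : (V → Circle) → ℝ, Continuous G →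
      ∫ u, G u ∂μ = ((2 * Real.pi)⁻¹) ^ Fintype.card V * ∫ θ in angleCube V, G (E θ) :=
    fun G hG => by
    rw [hμdef, CircleHaar.integral_pi_haarProbability_circle G hG.aestronglyMeasurable,
      CircleHaar.setIntegral_pi_Ioc_eq_pi_Ico, smul_eq_mul]
    rfl
  have harg : ∀ β r : ℝ, villainKernel β (Complex.arg (Circle.exp r : ℂ)) = villainKernel β r :=
    fun β r => by
    rw [Circle.coe_exp, Complex.arg_exp_mul_I, toIocMod]
    exact (show Function.Periodic (villainKernel β) (2 * Real.pi) from
      villainKernel_add_two_pi β).sub_zsmul_eq _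
  have hWE : ∀ θ : V → ℝ, Wt (E θ) = ∏ e, villainKernel (κ e) ((t e).elim (0 : ℝ) θ - (s e).elim 0 θ) := by
    intro θ
    simp only [hWtdef]
    refine Finset.prod_congr rfl fun e _ => ?_
    rw [hχdef, hχf, hextE, hextE, ← Circle.exp_sub, harg]
  have hfE : ∀ θ : V → ℝ, ((χ₀ (E θ) : Circle) : ℂ).re = Real.cos (a.elim (0 : ℝ) θ - b.elim 0 θ) := by
    intro θ
    rw [hχ₀def, hχf, hextE, hextE, ← Circle.exp_sub, Circle.coe_exp, Complex.exp_ofReal_mul_I_re]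
  have hc0 : (0 : ℝ) < ((2 * Real.pi)⁻¹) ^ Fintype.card V := by positivity
  have hG'c : Continuous fun u : V → Circle => ((χ₀ u : Circle) : ℂ).re * Wt u :=
    (continuous_re.comp (continuous_subtype_val.comp χ₀.continuous)).mul hWc
  have key := htr _ hG'c
  simp only [hWE, hfE] at key
  rw [hre] at key
  -- solve for the cube integral
  have h2π : (2 * Real.pi : ℝ) ≠ 0 := by positivity
  calc ∫ θ in angleCube V, Real.cos (a.elim (0 : ℝ) θ - b.elim 0 θ) *
          ∏ e, villainKernel (κ e) ((t e).elim (0 : ℝ) θ - (s e).elim 0 θ)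
      = (2 * Real.pi) ^ Fintype.card V * (((2 * Real.pi)⁻¹) ^ Fintype.card V *
          ∫ θ in angleCube V, Real.cos (a.elim (0 : ℝ) θ - b.elim 0 θ) *
            ∏ e, villainKernel (κ e) ((t e).elim (0 : ℝ) θ - (s e).elim 0 θ)) := by
        rw [← mul_assoc, ← mul_pow, mul_inv_cancel₀ h2π, one_pow, one_mul]
    _ = _ := by rw [← key]

/-- **Griffiths' first inequality for the pinned Villain model (numerator form)**:
`0 ≤ ∫_{[-π,π)^V} cos(θ̄_a − θ̄_b) ∏_e v_{κ_e}(θ̄(t e) − θ̄(s e)) dθ` — every term of the current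
expansion is non-negative. [cite: Ginibre1970, main theorem with the plane-rotator example cos(m·φ)] -/
theorem setIntegral_cos_mul_pinnedWeight_nonneg (s t : ι → Option V) {κ : ι → ℝ}
    (hκ : ∀ e, 0 < κ e) (a b : Option V) :
    0 ≤ ∫ θ in angleCube V, Real.cos (a.elim (0 : ℝ) θ - b.elim 0 θ) *
        ∏ e, villainKernel (κ e) ((t e).elim (0 : ℝ) θ - (s e).elim 0 θ) := by
  rw [setIntegral_cos_mul_pinnedWeight_eq_tsum s t hκ a b]
  refine mul_nonneg (by positivity) (tsum_nonneg fun n => ?_)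
  split_ifs
  · exact Finset.prod_nonneg fun e _ => (villainFourierCoeff_pos (hκ e) _).le
  · exact le_rfl

/-- **Griffiths' first inequality for the pinned Villain model (ratio form)**:
`0 ≤ ⟨cos(θ̄_a − θ̄_b)⟩_κ = (∫ cos(θ̄_a − θ̄_b) W_κ)/(∫ W_κ)` (`κ_e > 0`).
[cite: Ginibre1970, main theorem with the plane-rotator example cos(m·φ)] -/
theorem pinnedVillainTwoPoint_nonneg (s t : ι → Option V) {κ : ι → ℝ} (hκ : ∀ e, 0 < κ e)
    (a b : Option V) :
    0 ≤ (∫ θ in angleCube V, Real.cos (a.elim (0 : ℝ) θ - b.elim 0 θ) *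
        ∏ e, villainKernel (κ e) ((t e).elim (0 : ℝ) θ - (s e).elim 0 θ)) /
      ∫ θ in angleCube V, ∏ e, villainKernel (κ e) ((t e).elim (0 : ℝ) θ - (s e).elim 0 θ) :=
  div_nonneg (setIntegral_cos_mul_pinnedWeight_nonneg s t hκ a b) (setIntegral_pinnedWeight_pos s t hκ).le

open DirichletVillain in
/-- **Griffiths' first inequality for the Villain rotator with zero boundary condition**:
`0 ≤ ⟨S_0·S_x⟩_{□_n,β,0}` for every cube, `β > 0`, `x` (the cube model is a pinned Villain model,
`prod_villainKernel_toOpt_eq_weight`). [cite: Ginibre1970, main theorem with the plane-rotator example cos(m·φ)] -/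
theorem dirichletVillainTwoPoint_nonneg {d : ℕ} {β : ℝ} (hβ : 0 < β) (n : ℕ) (x : Site d) :
    0 ≤ dirichletVillainTwoPoint β n x := by
  have h := pinnedVillainTwoPoint_nonneg (V := SIdx d n) (ι := EIdx d n)
    (fun e => toOpt n e.1.1) (fun e => toOpt n (e.1.1 + Pi.single e.1.2 1))
    (κ := fun _ => β) (fun _ => hβ) (toOpt n 0) (toOpt n x)
  simp only [prod_villainKernel_toOpt_eq_weight, cos_toOpt_elim] at h
  exact h

/-- **The thermodynamic limit of the zero-boundary-condition Villain two-point function is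
non-negative** (`d ≥ 1`, `β > 0`): `0 ≤ inf_n ⟨S_0·S_x⟩_{□_n,β,0} = lim_n ⟨S_0·S_x⟩_{□_n,β,0}`.
[cite: DarioWu2020, Ch. 1 §1 (PDF p. 4)] -/
theorem ciInf_dirichletVillainTwoPoint_nonneg {d : ℕ} (hd : 0 < d) {β : ℝ} (hβ : 0 < β) (x : Site d) :
    0 ≤ ⨅ n : ℕ, dirichletVillainTwoPoint β n x :=
  ge_of_tendsto' (tendsto_dirichletVillainTwoPoint_ciInf hd hβ x) fun n => dirichletVillainTwoPoint_nonneg hβ n x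

end Literature.Probability.LatticeModels
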